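import Literature.NumberTheory.Automorphic.SmoothIndClosedCellNonzero
import Literature.NumberTheory.Automorphic.UnitaryGroupUnipotentLimitCompactOpen
import Literature.NumberTheory.Automorphic.UnitaryGroupPrincipalSeriesExponents
import Literature.NumberTheory.Automorphic.CongruenceSubgroupExpansionGL
import Literature.NumberTheory.Automorphic.AdicCompletionLocalField
import HarnessLib

/-!
# The local unitary group is non-archimedean; the Levi projection of its Borel is continuous; the principal series `i_G(χ)` of
# `U(Φ_N)(L⁺_v)` has a section `f(1) = 1` for CONTINUOUS `χ`, with non-zero class in the Jacquet module

Topic `NumberTheory/Automorphic`; namespace `Literature.NumberTheory.Automorphic.UnitaryGroup`.  THEOREMS ONLY: no definition, no named fact, no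
`sorry`, no instance, no notation.  Registry pub/hodgecm-mathlib F0∕P3: (i) node N1 of `F0_P3_KeysCaseTwoPaydown` (★ `U3PrincipalSeriesJacquetFiltration`,
[Casselman1995, Lemma 7.1.1 (a)]) — the CM discharge of the closed-cell lower bound «`ev₁ ≠ 0` on `r_B i_G(χ)`» (★ `SmoothIndClosedCellNonzero`);
(ii) rung-4 row (G1-i): `i_G(χ) ≠ 0` for every CONTINUOUS `χ` (the `hnt` hypothesis of the Summit-side `isXiLocalFamily_xiFamilyOfRecord_of_nontrivial`),
where ★ `isSpherical_cmPrincipalSeries` only covers unramified `χ`.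

## Contents
* §1 `nonarchimedeanGroup_localGL`, **`nonarchimedeanGroup_unitaryGroupOfForm_local`**: `GL_N(Π_{w∣v} E_w)` (★ `localGLPiEquiv` ≃ₜ* `Π_w GL_N(E_w)`,
  ★ `nonarchimedeanGroup_gl` at the local fields `E_w`) and every `U(c ⊗ 1, J')(F_v) ≤ GL_N(Π_w E_w)` are non-archimedean groups (open subgroups
  form a basis of neighbourhoods of `1`) [PlatonovRapinchuk1994, §3.3]; theorems for `haveI`, not instances.
* §2 (generic `U(σ, Φ_N)(R)`, `R` a topological ring) `continuous_torusEntry`, `continuous_torusDet`, **`continuous_proj_borelTriple`** — the Levi projection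
  `B → T`, `p ↦ diag(p_ii)` (★ `val_proj_borelTriple`), is continuous; `continuous_torusCharPair_apply` for `χ = (χ₁, χ₂)` with `χ₁`, `χ₂` continuous.
* §3 (CM, `G = U(Φ_N)(L⁺_v)`, every `N`, every finite `v`) **`exists_cmPrincipalSeries_toFun_one_eq_one`**: for a character `χ` of the diagonal torus with
  `t ↦ (χ t : ℂ)` continuous there is `f ∈ i_G(χ)` with `f(1) = 1` and `[f] ≠ 0` in the Jacquet-module carrier `((cmBorelTriple L N v).restrict (i_G χ)).Coinvariants`
  (★ `ParabolicTriple.exists_toFun_one_eq_one_and_mk_ne_zero`: `B` closed ★ `isClosed_borelU`, `N` a limit of compact opens ★ `isLimitOfCompactOpen_cmBorelTriple_N`,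
  `K_v = U(Φ_N)(𝒪_v)` compact open ★ `isCompact_isOpen_cmLocalIntegralLevel`); hence **`nontrivial_cmPrincipalSeries`** and the descended evaluation
  `E [f] = f(1)` is a NON-ZERO linear form on `r_B i_G(χ)` (`exists_linearMap_coinvariants_cmPrincipalSeries`); §4 the `N = 3` pair `cmTorusCharPair L v χ₁ χ₂`
  of ★ N1 with `χ₁`, `χ₂` continuous.  With the Summit-side ★ `F0P3U3PrincipalSeriesJacquetClosedCell.closedCell_cmPrincipalSeries` (`ℓ = ker ev₁`,
  `finrank (r ⧸ ℓ) ≤ 1`) this gives `r ⧸ ℓ ≠ 0` (a class `[f]` with `f(1) = 1` is outside `ℓ`, ★ `ParabolicTriple.mk_restrict_normalizedInd_notMem_of_toFun_one_ne_zero`).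

HC_CM is proved only modulo the printed citations until rung 0 closes; this file alone discharges no named fact.

## References
* [Casselman1995] W. Casselman, *Introduction to the theory of admissible representations of `p`-adic reductive groups* (draft 1 May 1995), §6.3,
  Lemma 7.1.1 (a).
* [BernsteinZelevinsky1977] I. N. Bernstein, A. V. Zelevinsky, Ann. Sci. ÉNS (4) 10 (1977), §1.8, §2.3, Geometrical Lemma 2.12.
* [Rogawski1990] J. Rogawski, Ann. of Math. Stud. 123 (1990), §1.10 p. 9 (Borel, torus), §12.1–12.2 pp. 171–174 (`i_G(χ)`).
* [PlatonovRapinchuk1994] V. Platonov, A. Rapinchuk, *Algebraic Groups and Number Theory* (1994), §3.3 (topology of `G(F_v)`), §5.1.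
-/

set_option autoImplicit false

noncomputable section

open scoped MatrixGroups
open Topology

namespace Literature.NumberTheory.Automorphic

namespace UnitaryGroup

/-! ## §1 Local unitary groups are non-archimedean -/

section Local

variable {F : Type} [Field F] [NumberField F] (E : Type) [Field E] [NumberField E] [Algebra F E]
  (c : E ≃ₐ[F] E) (N : ℕ) (v : _root_.IsDedekindDomain.HeightOneSpectrum (_root_.NumberField.RingOfIntegers F))
  (J' : Matrix (Fin N) (Fin N) (LocalRing E v))

omit [NumberField F] in
/-- **`GL_N(Π_{w ∣ v} E_w)` is a non-archimedean group**: `GL_N(Π_w E_w) ≃ₜ* Π_w GL_N(E_w)` (★ `localGLPiEquiv`) and each `GL_N(E_w)` is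
non-archimedean (★ `nonarchimedeanGroup_gl`, `E_w` a non-archimedean local field). [cite: PlatonovRapinchuk1994, §3.3] -/
theorem nonarchimedeanGroup_localGL : NonarchimedeanGroup (GL (Fin N) (LocalRing E v)) := by
  haveI : ∀ w : PlacesOver E v, NonarchimedeanGroup (GL (Fin N) (w.1.adicCompletion E)) :=
    fun w => nonarchimedeanGroup_gl (w.1.adicCompletion E) N
  exact NonarchimedeanGroup.of_isEmbedding (localGLPiEquiv E N v).toMonoidHom (localGLPiEquiv E N v).toHomeomorph.isEmbedding

/-- **Every local unitary group `U(c ⊗ 1, J')(F_v) ≤ GL_N(Π_{w∣v} E_w)` is a non-archimedean group** (subspace topology). [cite: PlatonovRapinchuk1994, §3.3] -/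
theorem nonarchimedeanGroup_unitaryGroupOfForm_local : NonarchimedeanGroup ↥(unitaryGroupOfForm (conjLocal E c v) J') := by
  haveI := nonarchimedeanGroup_localGL E N v
  exact NonarchimedeanGroup.subgroup _

end Local

/-! ## §2 Continuity of the torus coordinates and of the Levi projection of the Borel of `U(σ, Φ_N)(R)` -/

section Generic

variable {R : Type*} [CommRing R] [TopologicalSpace R] [IsTopologicalRing R] (σ : R →+* R) {N : ℕ} (J : Matrix (Fin N) (Fin N) R)
  (hJ : J = (StdForm.antidiagonal N).over R)

omit [IsTopologicalRing R] in
/-- the matrix entries of an element of a subgroup of `U(σ, J)(R)` depend continuously on it. [cite: Rogawski1990, §1.10 p. 9] -/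
theorem continuous_apply_apply_subgroup (S : Subgroup ↥(unitaryGroupOfForm σ J)) (i j : Fin N) :
    Continuous fun s : S => (((s : ↥(unitaryGroupOfForm σ J)) : GL (Fin N) R) : Matrix (Fin N) (Fin N) R) i j :=
  ((Units.continuous_val.comp (continuous_subtype_val.comp continuous_subtype_val)).matrix_elem i j)

/-- **the torus coordinate `t ↦ t_ii : T →* Rˣ` is continuous** (for the unit-group topology on `Rˣ`): its value is the `(i,i)` entry of `t` and the
value of its inverse the `(i,i)` entry of `t⁻¹` (★ `coe_torusEntry`). [cite: Rogawski1990, §1.10 p. 9] -/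
theorem continuous_torusEntry (i : Fin N) : Continuous (torusEntry σ J i) := by
  refine Units.continuous_iff.2 ⟨?_, ?_⟩
  · exact (continuous_apply_apply_subgroup σ J _ i i).congr fun t => (coe_torusEntry σ J i t).symm
  · refine ((continuous_apply_apply_subgroup σ J _ i i).comp continuous_inv).congr fun t => ?_
    change (((t⁻¹ : ↥(torusU σ J)) : ↥(unitaryGroupOfForm σ J)) : GL (Fin N) R).val i i = (((torusEntry σ J i t)⁻¹ : Rˣ) : R)
    rw [← map_inv, coe_torusEntry]

/-- **`det : T →* Rˣ` is continuous**. [cite: Rogawski1990, §1.10 p. 9] -/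
theorem continuous_torusDet : Continuous (torusDet σ J) := by
  have hval : Continuous fun t : ↥(torusU σ J) => (((t : ↥(unitaryGroupOfForm σ J)) : GL (Fin N) R) : Matrix (Fin N) (Fin N) R) :=
    Units.continuous_val.comp (continuous_subtype_val.comp continuous_subtype_val)
  refine Units.continuous_iff.2 ⟨?_, ?_⟩
  · exact hval.matrix_det.congr fun t => rfl
  · refine (hval.matrix_det.comp continuous_inv).congr fun t => ?_
    change ((((t⁻¹ : ↥(torusU σ J)) : ↥(unitaryGroupOfForm σ J)) : GL (Fin N) R) : Matrix (Fin N) (Fin N) R).det =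
      (((torusDet σ J t)⁻¹ : Rˣ) : R)
    rw [← map_inv]
    rfl

/-- **`torusDetNormOne : T →* E¹` is continuous** (`E¹ = normOneUnits σ ≤ Rˣ`). [cite: Rogawski1990, §1.10 p. 9] -/
theorem continuous_torusDetNormOne : Continuous (torusDetNormOne σ J hJ) :=
  (continuous_torusDet σ J).subtype_mk _

/-- **a character pair `χ = (χ₁, χ₂)` of the torus is continuous when `χ₁ : Rˣ → ℂ` and `χ₂ : E¹ → ℂ` are** (★ `torusCharPair_apply`).
[cite: Rogawski1990, §12.1 p. 171] -/
theorem continuous_torusCharPair_apply (i : Fin N) (χ₁ : Rˣ →* ℂˣ) (χ₂ : ↥(normOneUnits σ) →* ℂˣ)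
    (h₁ : Continuous fun x => ((χ₁ x : ℂˣ) : ℂ)) (h₂ : Continuous fun x => ((χ₂ x : ℂˣ) : ℂ)) :
    Continuous fun t => ((torusCharPair σ J hJ i χ₁ χ₂ t : ℂˣ) : ℂ) := by
  simp only [torusCharPair_apply, Units.val_mul]
  exact (h₁.comp (continuous_torusEntry σ J i)).mul (h₂.comp (continuous_torusDetNormOne σ J hJ))

/-- **the Levi projection `proj : B → T` of the Borel triple is continuous**: on matrices it is `p ↦ diag(p_ii)` (★ `val_proj_borelTriple`) with inverse
`p ↦ diag((p⁻¹)_ii)` (★ `val_proj_inv_borelTriple`), both continuous in `p`. [cite: Rogawski1990, §1.10 p. 9] [cite: BernsteinZelevinsky1977, §1.8] -/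
theorem continuous_proj_borelTriple : Continuous (borelTriple σ J hJ).proj := by
  -- continuity into `T ≤ U(σ,J) ≤ GL_N(R)`: it suffices to check the composite into `GL_N(R)`
  refine continuous_induced_rng.2 (continuous_induced_rng.2 ?_)
  have hdiag : Continuous fun p : ↥(borelTriple σ J hJ).P =>
      Matrix.diagonal fun i => ((((p : ↥(borelTriple σ J hJ).P) : ↥(unitaryGroupOfForm σ J)) : GL (Fin N) R) : Matrix (Fin N) (Fin N) R) i i :=
    (continuous_pi fun i => continuous_apply_apply_subgroup σ J _ i i).matrix_diagonal
  refine Units.continuous_iff.2 ⟨hdiag.congr fun p => (val_proj_borelTriple σ J hJ p).symm, ?_⟩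
  refine (hdiag.comp continuous_inv).congr fun p => ?_
  exact (val_proj_inv_borelTriple σ J hJ p).symm

/-- hence `p ↦ χ(proj p)` is continuous on `B` for every character `χ` of `T` with `t ↦ (χ t : ℂ)` continuous. [cite: Rogawski1990, §12.1 p. 171] -/
theorem continuous_apply_proj_borelTriple (χ : ↥(torusU σ J) →* ℂˣ) (hχ : Continuous fun t => ((χ t : ℂˣ) : ℂ)) :
    Continuous fun p : ↥(borelTriple σ J hJ).P => ((χ ((borelTriple σ J hJ).proj p) : ℂˣ) : ℂ) :=
  hχ.comp (continuous_proj_borelTriple σ J hJ)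

end Generic

/-! ## §3 The CM principal series: a section `f(1) = 1` with non-zero Jacquet class, for every continuous `χ` -/

section CM

open _root_.NumberField _root_.IsDedekindDomain

variable (L : Type) [Field L] [NumberField L] [IsCMField L] (N : ℕ) (v : HeightOneSpectrum (𝓞 ↥(maximalRealSubfield L)))

/-- **`U(Φ_N)(L⁺_v)` is a non-archimedean group.** [cite: PlatonovRapinchuk1994, §3.3] -/
theorem nonarchimedeanGroup_cmLocal :
    NonarchimedeanGroup ↥(unitaryGroupOfForm (conjLocal L (IsCMField.complexConj L) v) (cmLocalForm L N v)) :=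
  nonarchimedeanGroup_unitaryGroupOfForm_local (E := L) (c := IsCMField.complexConj L) (N := N) (v := v) (J' := cmLocalForm L N v)

set_option maxHeartbeats 400000 in
set_option synthInstance.maxHeartbeats 400000 in
/-- **A SECTION OF `i_G(χ)` WITH `f(1) = 1` AND NON-ZERO JACQUET CLASS, for every CONTINUOUS character `χ` of the diagonal torus of
`G = U(Φ_N)(L⁺_v)`** (every `N`, every finite place `v` of `L⁺`): ★ `ParabolicTriple.exists_toFun_one_eq_one_and_mk_ne_zero` at the Borel triple
★ `cmBorelTriple L N v` — `G` non-archimedean (§1), `B` closed (★ `isClosed_borelU`), `N` a limit of compact opens (★ `isLimitOfCompactOpen_cmBorelTriple_N`),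
`K_v = U(Φ_N)(𝒪_v)` compact open (★ `isCompact_isOpen_cmLocalIntegralLevel`), `χ ∘ proj` continuous (§2).  The closed Bruhat cell's contribution to
`r_B i_G(χ)` [Casselman1995, Lemma 7.1.1 (a)]. [cite: Casselman1995, Lemma 7.1.1 (a) and §6.3] [cite: Rogawski1990, §12.2 pp. 173–174] -/
theorem exists_cmPrincipalSeries_toFun_one_eq_one
    (χ : ↥(torusU (conjLocal L (IsCMField.complexConj L) v) (cmLocalForm L N v)) →* ℂˣ) (hχ : Continuous fun t => ((χ t : ℂˣ) : ℂ)) :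
    haveI := locallyCompactSpace_cmBorelU L N v
    ∃ f : Representation.SmoothInd (cmBorelTriple L N v).P
        (Representation.twist
          (((Representation.trivial ℂ ↥(torusU (conjLocal L (IsCMField.complexConj L) v) (cmLocalForm L N v)) ℂ).twist χ).comp
            (cmBorelTriple L N v).proj) (rootDeltaChar (cmBorelTriple L N v).P)),
      f.toFun 1 = 1 ∧ Representation.Coinvariants.mk ((cmBorelTriple L N v).restrict (cmPrincipalSeries L N v χ)) f ≠ 0 := by
  haveI := locallyCompactSpace_cmBorelU L N v
  haveI := nonarchimedeanGroup_cmLocal L N v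
  have hK := isCompact_isOpen_cmLocalIntegralLevel L N (Matrix.of fun i j : Fin N => if i.val + j.val + 1 = N then (1 : L) else 0) v
  exact (cmBorelTriple L N v).exists_toFun_one_eq_one_and_mk_ne_zero
    (isClosed_borelU (conjLocal L (IsCMField.complexConj L) v) (cmLocalForm L N v)) (isLimitOfCompactOpen_cmBorelTriple_N L N v) hK.2 hK.1 χ
    (continuous_apply_proj_borelTriple (conjLocal L (IsCMField.complexConj L) v) (cmLocalForm L N v) (cmLocalForm_eq_over L N v) χ hχ)

set_option synthInstance.maxHeartbeats 400000 in
/-- **`i_G(χ) ≠ 0` for every continuous character `χ` of the torus of `U(Φ_N)(L⁺_v)`** (the CM sequel of ★ `SmoothInductionNontrivial`; rung-4 row (G1-i):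
the `hnt` input of the ξ-local family of record at ALL non-split places, ramified `χ` included). [cite: Rogawski1990, §12.2 pp. 173–174] [cite: BernsteinZelevinsky1977, §2.3] -/
theorem nontrivial_cmPrincipalSeries
    (χ : ↥(torusU (conjLocal L (IsCMField.complexConj L) v) (cmLocalForm L N v)) →* ℂˣ) (hχ : Continuous fun t => ((χ t : ℂˣ) : ℂ)) :
    haveI := locallyCompactSpace_cmBorelU L N v
    Nontrivial (Representation.SmoothInd (cmBorelTriple L N v).P
        (Representation.twist
          (((Representation.trivial ℂ ↥(torusU (conjLocal L (IsCMField.complexConj L) v) (cmLocalForm L N v)) ℂ).twist χ).comp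
            (cmBorelTriple L N v).proj) (rootDeltaChar (cmBorelTriple L N v).P))) := by
  obtain ⟨f, hf1, -⟩ := exists_cmPrincipalSeries_toFun_one_eq_one L N v χ hχ
  refine ⟨⟨f, 0, fun h => one_ne_zero (α := ℂ) ?_⟩⟩
  rw [← hf1, h]
  rfl

set_option synthInstance.maxHeartbeats 400000 in
/-- **The descended evaluation `E : r_B i_G(χ) → ℂ`, `E [f] = f(1)`, is a NON-ZERO linear form on the Jacquet-module carrier** (★
`ParabolicTriple.exists_linearMap_coinvariants_ne_zero`): the closed cell survives in `r_B i_G(χ)`, and `E` kills every class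
of a function vanishing at `1` (the open-cell part). [cite: Casselman1995, Lemma 7.1.1 (a)] [cite: BernsteinZelevinsky1977, Geometrical Lemma 2.12 (closed orbit)] -/
theorem exists_linearMap_coinvariants_cmPrincipalSeries
    (χ : ↥(torusU (conjLocal L (IsCMField.complexConj L) v) (cmLocalForm L N v)) →* ℂˣ) (hχ : Continuous fun t => ((χ t : ℂˣ) : ℂ)) :
    haveI := locallyCompactSpace_cmBorelU L N v
    ∃ E : ((cmBorelTriple L N v).restrict (cmPrincipalSeries L N v χ)).Coinvariants →ₗ[ℂ] ℂ,
      (∀ f, E (Representation.Coinvariants.mk _ f) = f.toFun 1) ∧ E ≠ 0 := by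
  haveI := locallyCompactSpace_cmBorelU L N v
  haveI := nonarchimedeanGroup_cmLocal L N v
  have hK := isCompact_isOpen_cmLocalIntegralLevel L N (Matrix.of fun i j : Fin N => if i.val + j.val + 1 = N then (1 : L) else 0) v
  exact (cmBorelTriple L N v).exists_linearMap_coinvariants_ne_zero
    (isClosed_borelU (conjLocal L (IsCMField.complexConj L) v) (cmLocalForm L N v)) (isLimitOfCompactOpen_cmBorelTriple_N L N v) hK.2 hK.1 χ
    (continuous_apply_proj_borelTriple (conjLocal L (IsCMField.complexConj L) v) (cmLocalForm L N v) (cmLocalForm_eq_over L N v) χ hχ)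

end CM

/-! ## §4 `N = 3`: the pair `χ = (χ₁, χ₂)` of ★ `U3PrincipalSeriesJacquetFiltration` -/

section Three

open _root_.NumberField _root_.IsDedekindDomain

variable (L : Type) [Field L] [NumberField L] [IsCMField L] (v : HeightOneSpectrum (𝓞 ↥(maximalRealSubfield L)))
  (χ₁ : (LocalRing L v)ˣ →* ℂˣ) (χ₂ : ↥(normOneUnits (conjLocal L (IsCMField.complexConj L) v)) →* ℂˣ)

/-- **`χ = (χ₁, χ₂)` is continuous on the torus when `χ₁`, `χ₂` are** (★ `cmTorusCharPair` = ★ `torusCharPair` at the CM data).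
[cite: Rogawski1990, §12.1 p. 171] -/
theorem continuous_cmTorusCharPair_apply (h₁ : Continuous fun x => ((χ₁ x : ℂˣ) : ℂ)) (h₂ : Continuous fun x => ((χ₂ x : ℂˣ) : ℂ)) :
    Continuous fun t => ((cmTorusCharPair L v χ₁ χ₂ t : ℂˣ) : ℂ) :=
  continuous_torusCharPair_apply (conjLocal L (IsCMField.complexConj L) v) (cmLocalForm L 3 v) (cmLocalForm_eq_over L 3 v) 0 χ₁ χ₂ h₁ h₂

set_option synthInstance.maxHeartbeats 400000 in
/-- **N1, closed-cell lower bound**: for continuous `χ₁`, `χ₂` there is `f ∈ i_G(χ₁, χ₂)` with `f(1) = 1` and `[f] ≠ 0` in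
`r = ((cmBorelTriple L 3 v).restrict (cmPrincipalSeries L 3 v (cmTorusCharPair L v χ₁ χ₂))).Coinvariants` — the carrier of ★ `U3PrincipalSeriesJacquetFiltration`
— and a linear form `E` on `r` with `E [g] = g(1)`, `E ≠ 0`. [cite: Casselman1995, Lemma 7.1.1 (a)] [cite: Rogawski1990, §12.2 pp. 173–174] -/
theorem exists_cmPrincipalSeries_cmTorusCharPair_toFun_one_eq_one (h₁ : Continuous fun x => ((χ₁ x : ℂˣ) : ℂ))
    (h₂ : Continuous fun x => ((χ₂ x : ℂˣ) : ℂ)) :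
    haveI := locallyCompactSpace_cmBorelU L 3 v
    (∃ f : Representation.SmoothInd (cmBorelTriple L 3 v).P
        (Representation.twist
          (((Representation.trivial ℂ ↥(torusU (conjLocal L (IsCMField.complexConj L) v) (cmLocalForm L 3 v)) ℂ).twist
            (cmTorusCharPair L v χ₁ χ₂)).comp (cmBorelTriple L 3 v).proj) (rootDeltaChar (cmBorelTriple L 3 v).P)),
      f.toFun 1 = 1 ∧
        Representation.Coinvariants.mk ((cmBorelTriple L 3 v).restrict (cmPrincipalSeries L 3 v (cmTorusCharPair L v χ₁ χ₂))) f ≠ 0) ∧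
    ∃ E : ((cmBorelTriple L 3 v).restrict (cmPrincipalSeries L 3 v (cmTorusCharPair L v χ₁ χ₂))).Coinvariants →ₗ[ℂ] ℂ,
      (∀ f, E (Representation.Coinvariants.mk _ f) = f.toFun 1) ∧ E ≠ 0 :=
  ⟨exists_cmPrincipalSeries_toFun_one_eq_one L 3 v _ (continuous_cmTorusCharPair_apply L v χ₁ χ₂ h₁ h₂),
    exists_linearMap_coinvariants_cmPrincipalSeries L 3 v _ (continuous_cmTorusCharPair_apply L v χ₁ χ₂ h₁ h₂)⟩

end Three

end UnitaryGroup

end Literature.NumberTheory.Automorphic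

end
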